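import Summits.QuantumFields.YangMills.Theorems.BalabanUVNodesN21HistoriesLiftedStageLaws
import Literature.MathematicalPhysics.QuantumFieldTheory.Balaban1983to89.Node00.RStepRepr218

/-!
# N21 (NE7c) — module 38d «THE ONE-LEVEL DICTIONARY IN THE KERNEL»: at def-R's single-level letters (no older coordinates, no forward kernel)
# 38a's `NotRead` IS `T4DressedR.FibreIndep`, b01's real `normTerm` cast to `ℝ≥0∞` IS the hybrid lift with `O = ∅`, and def-R FILE 7's ℝ-summand
# `t_{a″}·∫⌈t_a∕∫⌈t_{a″}` of a sent sequence IS 38b's lifted density with the RECEIVER-LAW INSERT — the insert the record's ℝ carries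

Seat `pub-ymgap-dag-n21-e` (g12), own hand; lane `--kind proof --supports stmt-QuantumFields-20544 --as helper` (K3⁷ `SpineGivenEndpointR13SepCoPH`).
Count-neutral.

WHY.  The lens's Card 56 (L2) sentence «the lift's older-integral is def-R's `rstepOfSel` term» and Card 61's «every typed ℝ-object of the tree re-draws
`Z′` from the RECEIVER's conditional law ((0.3) literally: def-R `RStepRepr218.rratio`, b01 `normTerm`)» are made kernel facts at def-R's letters: with
`O = ∅` (def-R's one-level density model, older levels integrated inside `TexpA`) and `Φ = 1`, over `fieldMeasure = Measure.pi Haar`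
(b01 `fieldMeasure_eq_pi`), (i) `notRead_iff_fibreIndep` (`Iff.rfl`); (ii) `ofReal_normTerm_eq_hybridLift` — b01's REAL normalised term
`new·(∫⌈old ∕ ∫⌈new)` cast to `ℝ≥0∞` IS `hybridLift Haar ∅ s (ofReal ∘ new) (ofReal ∘ old)` under nonnegativity of `new`, finiteness of the two fibre
integrals and the SUPPORT proviso (`∫⌈new = 0 ⇒ ∫⌈old = 0`; then both sides read `0`, real `x∕0 = 0` matching `ℝ≥0∞`'s `0∕0 = 0`); (iii)
`ofReal_rsummand_eq_liftDensity` — FILE 7's summand `rterm r (sel a) · rratio r fib a (sel a)` of a SENT sequence `a` (`sel a ≠ a`) IS 38b's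
`liftDensity Haar ∅ fib sel ins d a` with `d a := ofReal ∘ rterm r a` and the RECEIVER-LAW INSERT `ins a := ofReal ∘ rterm r (sel a)`; (iv)
`withDensity_rsummand_eq_postLaw` — its law under `fieldMeasure` IS 38b's `postLaw` (`O = ∅`, `Φ = 1`).  CONSEQUENCE (located, lens v22.0 Cards 61∕63∕64, ROW P″ — READ BEFORE FILING):
the record's ℝ carries the receiver-law insert.  On the UNREFINED sent family of record NEITHER insert instantiates 38b∕38c's (Eon) pair jointly on
sharp-threshold terms — receiver-law insert: `hdom` trivial but NO finite exterior-uniform `hquot` (Card 61, Sketch-g21 §T); window insert: `hquot`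
exterior-uniform ([LF-II] p. 358) but `hdom` fails off the half-threshold branch (Sketch-g22 §W).  THE CURE IS ONE FACTOR ON THE SENT TERM (Card 63):
print's (1.88) p. 197 decomposition of unity `φ_s` of the EXTERIOR boundary layer at half threshold, `IndepOf (O ∪ F s) φ_s`, commutes with the lift; on
the (1.88)-REFINED sent family `d s ↦ φ_s·d s` (births `(1−φ_s)·d s` = separate unsent index elements, ROW B′) BOTH inserts work, in particular the
receiver-law insert OF RECORD typed here: `hdom` with `B = 1`, `q_R ≤ q_W·B_nest` by nesting (Card 64; lens Sketch-g22 §B `hq_receiver_of_window`).  So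
the record's insert is INCOMPLETE BY ONE EXTERIOR FACTOR, not wrong; 38c's `hquot`∕`hdom` are to be instantiated on the (1.88)-refined sent family
(this supersedes the «no finite q for the receiver-law insert» sentences of 38b∕38c's docstrings, which hold for the UNREFINED family only); constants
boundedness-only (`q·B ≤ exp(−c p₀(g_k) + O(1)M⁵)`, [LF-II] p. 369 ∕ (1.11) ∕ p. 358 — located, not typed).

HONEST FRAMING.  [folklore] casts (`ENNReal.ofReal`∕`toReal`) + bookkeeping; 0 def, 0 sorry; NOTHING of Bałaban's is asserted (context only:
[Balaban1989LargeFieldI] (0.3)–(0.4) p. 176, (1.100)–(1.102) pp. 200–201); NE7c ((M1) at the live slots) is NOT PRINTED and NOT PROVED; N21 NOT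
discharged; count-neutral; one finite 𝕋⁴ at fixed ε — nothing about ℝ⁴ ∕ OS ∕ mass gap ∕ Clay.

CITATION HEADER (lean-in-tree rule).  BY NAME: 38a `N21HybridResamplingLift.hybridLift` ∕ `NotRead`; 38b `N21HistoriesLiftedStageLaws.hybridLift_empty` ∕
`liftDensity` ∕ `liftDensity_of_ne` ∕ `postLaw`; b01 `B15.BasicStep.fibreIntegral` ∕ `normTerm` ∕ `fieldMeasure_eq_pi`; `T4DressedR.FibreIndep`; def-R
FILE 7 `Node00.rterm` ∕ `Node00.rratio` (`RStepRepr218`).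
-/

set_option autoImplicit false

open MeasureTheory Set Function
open scoped BigOperators ENNReal
open Literature.MathematicalPhysics.QuantumFieldTheory.Balaban1983to89
open Literature.MathematicalPhysics.QuantumFieldTheory.Balaban1983to89.B15.BasicStep

namespace Summit.QuantumFields.YangMills.Theorems.N21HybridLiftOneLevel

open Summit.QuantumFields.YangMills.Theorems.N21HybridResamplingLift (hybridLift NotRead)
open Summit.QuantumFields.YangMills.Theorems.N21HistoriesLiftedStageLaws
open Literature.MathematicalPhysics.QuantumFieldTheory.Balaban1983to89.Node00 (rterm rratio)

variable {P : Params} {j : ℕ} {G : Type*} [GaugeGroup G] [MeasurableSpace G] [HaarData G] [DecidableEq (PBond P j)]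

/-! ## §1 `NotRead` is `FibreIndep` -/

omit [GaugeGroup G] [MeasurableSpace G] [HaarData G] in
/-- **38a's `NotRead` IS def-R's `FibreIndep`** on the one-level space `GaugeField P j G = (PBond P j → G)` (both say: the statistic is unchanged by any
re-setting of the bond variables in `s`). [folklore] -/
theorem notRead_iff_fibreIndep (s : Finset (PBond P j)) (u : GaugeField P j G → ℝ) :
    NotRead (X := fun _ : PBond P j => G) s u ↔ T4DressedR.FibreIndep s u := Iff.rfl

/-! ## §2 b01's real normalised term, cast to `ℝ≥0∞`, IS the hybrid lift with no older coordinates -/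

/-- the cast of a real quotient of `toReal`s back to `ℝ≥0∞` is the `ℝ≥0∞` quotient, under finiteness and the SUPPORT proviso (`b = 0 ⇒ a = 0`:
real `x∕0 = 0` matches `0∕0 = 0`). [textbook] -/
theorem ofReal_div_toReal {a b : ℝ≥0∞} (ha : a ≠ ∞) (hb : b ≠ ∞) (hsupp : b = 0 → a = 0) :
    ENNReal.ofReal (a.toReal / b.toReal) = a / b := by
  by_cases h0 : b = 0
  · rw [h0, hsupp h0]; simp
  · rw [ENNReal.ofReal_div_of_pos (ENNReal.toReal_pos h0 hb), ENNReal.ofReal_toReal ha, ENNReal.ofReal_toReal hb]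

/-- **b01's `normTerm`, cast to `ℝ≥0∞`, IS `hybridLift Haar ∅ s (ofReal ∘ new) (ofReal ∘ old)`** at every field where the receiver density `new` is
nonnegative, both fibre integrals are finite and the SUPPORT proviso holds (receiver's fibre integral `= 0 ⇒` sender's `= 0`) — lens Card 56 (L2) ∕
Card 61 «the (0.3)-literal insert is the RECEIVER's law» at b01's letters (the same identity serves the (1.88)-refined sender `φ·old` against the same
insert — lens Card 63: the branch factor rides on the sent term). [cite: Balaban1989LargeFieldI, (0.3) p.176] -/
theorem ofReal_normTerm_eq_hybridLift (s : Finset (PBond P j)) (new old : Density P j G) (V : GaugeField P j G) (hnew : 0 ≤ new V)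
    (hold_top : (∫⋯∫⁻_s, (fun U => ENNReal.ofReal (old U)) ∂fun _ : PBond P j => (HaarData.haar : Measure G)) V ≠ ∞)
    (hnew_top : (∫⋯∫⁻_s, (fun U => ENNReal.ofReal (new U)) ∂fun _ : PBond P j => (HaarData.haar : Measure G)) V ≠ ∞)
    (hsupp : (∫⋯∫⁻_s, (fun U => ENNReal.ofReal (new U)) ∂fun _ : PBond P j => (HaarData.haar : Measure G)) V = 0 →
      (∫⋯∫⁻_s, (fun U => ENNReal.ofReal (old U)) ∂fun _ : PBond P j => (HaarData.haar : Measure G)) V = 0) :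
    ENNReal.ofReal (normTerm s new old V) =
      hybridLift (fun _ : PBond P j => (HaarData.haar : Measure G)) ∅ s (fun U => ENNReal.ofReal (new U)) (fun U => ENNReal.ofReal (old U)) V := by
  rw [hybridLift_empty]
  simp only [normTerm, fibreIntegral]
  rw [ENNReal.ofReal_mul hnew, ofReal_div_toReal hold_top hnew_top hsupp]

/-! ## §3 def-R FILE 7's ℝ-summand of a sent sequence IS 38b's lifted density with the RECEIVER-LAW insert; its law IS 38b's `postLaw` -/

/-- the ℝ-summand `t_{a″}(V)·∫⌈_{Z′_a}t_a ∕ ∫⌈_{Z′_a}t_{a″}` distributed back to the sender `a` is b01's `normTerm (fib a) (rterm r (sel a)) (rterm r a)`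
(definitional; n21-e 23 §3 `normTerm_rterm_eq_mul_rratio` states the same at `rstepOfSel`'s letters). [cite: Balaban1989LargeFieldI, (0.3) p.176 (bookkeeping)] -/
theorem rterm_mul_rratio_eq_normTerm (r : Step.Repr218 P G j) (sel : r.Adm → r.Adm) (fib : r.Adm → Finset (PBond P j)) (a : r.Adm)
    (V : GaugeField P j G) : rterm r (sel a) V * rratio r fib a (sel a) V = normTerm (fib a) (rterm r (sel a)) (rterm r a) V := rfl

/-- **def-R's ℝ-SUMMAND OF A SENT SEQUENCE IS THE ONE-LEVEL LIFTED DENSITY WITH THE RECEIVER-LAW INSERT**: for `sel a ≠ a`,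
`ofReal (t_{a″}·∫⌈t_a∕∫⌈t_{a″}) = liftDensity Haar ∅ fib sel (ins := ofReal ∘ t ∘ sel) (d := ofReal ∘ t) a` pointwise, under nonnegativity of the
receiver term, finiteness and the support proviso. [cite: Balaban1989LargeFieldI, (0.3) p.176] -/
theorem ofReal_rsummand_eq_liftDensity (r : Step.Repr218 P G j) [DecidableEq r.Adm] (sel : r.Adm → r.Adm) (fib : r.Adm → Finset (PBond P j)) {a : r.Adm}
    (ha : sel a ≠ a) (V : GaugeField P j G) (hrecv : 0 ≤ rterm r (sel a) V)
    (hold_top : (∫⋯∫⁻_(fib a), (fun U => ENNReal.ofReal (rterm r a U)) ∂fun _ : PBond P j => (HaarData.haar : Measure G)) V ≠ ∞)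
    (hnew_top : (∫⋯∫⁻_(fib a), (fun U => ENNReal.ofReal (rterm r (sel a) U)) ∂fun _ : PBond P j => (HaarData.haar : Measure G)) V ≠ ∞)
    (hsupp : (∫⋯∫⁻_(fib a), (fun U => ENNReal.ofReal (rterm r (sel a) U)) ∂fun _ : PBond P j => (HaarData.haar : Measure G)) V = 0 →
      (∫⋯∫⁻_(fib a), (fun U => ENNReal.ofReal (rterm r a U)) ∂fun _ : PBond P j => (HaarData.haar : Measure G)) V = 0) :
    ENNReal.ofReal (rterm r (sel a) V * rratio r fib a (sel a) V) =
      liftDensity (fun _ : PBond P j => (HaarData.haar : Measure G)) ∅ fib sel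
        (fun b U => ENNReal.ofReal (rterm r (sel b) U)) (fun b U => ENNReal.ofReal (rterm r b U)) a V := by
  rw [liftDensity_of_ne ha, rterm_mul_rratio_eq_normTerm]
  exact ofReal_normTerm_eq_hybridLift (fib a) (rterm r (sel a)) (rterm r a) V hrecv hold_top hnew_top hsupp

/-- **… AND ITS LAW IS 38b's `postLaw`** (`O = ∅`, `Φ = 1`) under the cell's field law `fieldMeasure = Measure.pi Haar`: the record's one-level post-ℝ
stage law of a sent sequence, i.e. 20n's `J` at ONE level with the receiver-law insert. [cite: Balaban1989LargeFieldI, (0.3) p.176] -/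
theorem withDensity_rsummand_eq_postLaw (r : Step.Repr218 P G j) [DecidableEq r.Adm] (sel : r.Adm → r.Adm) (fib : r.Adm → Finset (PBond P j)) {a : r.Adm}
    (ha : sel a ≠ a) (hrecv : ∀ V, 0 ≤ rterm r (sel a) V)
    (hold_top : ∀ V, (∫⋯∫⁻_(fib a), (fun U => ENNReal.ofReal (rterm r a U)) ∂fun _ : PBond P j => (HaarData.haar : Measure G)) V ≠ ∞)
    (hnew_top : ∀ V, (∫⋯∫⁻_(fib a), (fun U => ENNReal.ofReal (rterm r (sel a) U)) ∂fun _ : PBond P j => (HaarData.haar : Measure G)) V ≠ ∞)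
    (hsupp : ∀ V, (∫⋯∫⁻_(fib a), (fun U => ENNReal.ofReal (rterm r (sel a) U)) ∂fun _ : PBond P j => (HaarData.haar : Measure G)) V = 0 →
      (∫⋯∫⁻_(fib a), (fun U => ENNReal.ofReal (rterm r a U)) ∂fun _ : PBond P j => (HaarData.haar : Measure G)) V = 0) :
    (fieldMeasure P j G).withDensity (fun V => ENNReal.ofReal (rterm r (sel a) V * rratio r fib a (sel a) V)) =
      postLaw (fun _ : PBond P j => (HaarData.haar : Measure G)) ∅ fib sel (fun _ => 1)
        (fun b U => ENNReal.ofReal (rterm r (sel b) U)) (fun b U => ENNReal.ofReal (rterm r b U)) a := by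
  rw [postLaw, fieldMeasure_eq_pi]
  refine withDensity_congr_ae (Filter.Eventually.of_forall fun V => ?_)
  show ENNReal.ofReal (rterm r (sel a) V * rratio r fib a (sel a) V) = liftDensity _ ∅ fib sel _ _ a V * 1
  rw [mul_one]
  exact ofReal_rsummand_eq_liftDensity r sel fib ha V (hrecv V) (hold_top V) (hnew_top V) (hsupp V)

end Summit.QuantumFields.YangMills.Theorems.N21HybridLiftOneLevel
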